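import Mathlib
import Literature.NumberTheory.LFunctions.Zhang2022.Section15CEq1522OfContour
import Literature.NumberTheory.LFunctions.Zhang2022.AppendixBLemma151LineShift

/-!
# Zhang (2022) Appendix B, proof of Lemma 15.1: the case `μ = 2` CLOSED in the reading of record —
# `Σ_l ϰ₂(l₁l)ϱ_j(l)/l = e_{2j} + O(α₁)` (`Typed.AppendixB.StepB_mu2R`)

Topic `Literature/NumberTheory/LFunctions/Zhang2022` (Landau–Siegel audit tree; verdict-neutral).
Y. Zhang, *Discrete mean estimates and the Landau–Siegel zero*, arXiv:2211.02515v1 (2022)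
[Zhang2022LandauSiegel] — **an unrefereed manuscript under adjudication; nothing in this file
asserts any claim of the manuscript beyond the displayed step it PROVES.** ZHANG-L discharge lane
(WP15, App. B blocks B1+B2 under the leaf `Typed.Section15C.Eq15_22`, Lemma 15.1 χ-reading), DAG
node `Z22:§B.u011` (closing sentence, "These together complete the proof in case `μ = 2`")
[Z22 p.107, tex L5309], typed in the `α₁ = α log T` reading of record as
`Typed.AppendixB.StepB_mu2R`.

PROVED: `stepB_mu2R_holds : StepB_mu2R c′` — zl-w15-p5's composition edge
`Skeleton.stepB_mu2R_of_u009rR : StepB_u009rR c′ → StepB_mu2R c′` (`Section15CEq1522OfContour`,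
over `stepB_u009_holds`, `intB2_circle_split`, `circleIntegral_intB2_zero_sub_resZero2_le`,
`stepB_u011a_holds`, `stepB_u011bR_holds`) applied to the contour shift `stepB_u009rR_holds`
(`AppendixBLemma151LineShift`). This is the first of the three line-to-circle legs of
`Typed.Section15C.eq15_22D_of_contour_legs`; the `μ = 3` / `μ = 1` legs are the twins of
`stepB_u009rR_holds` with `(P₃, β₆)` / `(P₁, β₆)` in place of `(P₂, β₇)`.

WHAT THIS IS NOT: the cases `μ = 1, 3`, Lemma 15.1 itself, or any claim about Theorems 1–2 /
Landau–Siegel zeros.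

## References

* Y. Zhang, arXiv:2211.02515v1 (2022), App. B p. 107. [cite: Zhang2022LandauSiegel, App. B p.107]
-/

noncomputable section

namespace Literature.NumberTheory.LFunctions.Zhang2022.Skeleton

/-- **`StepB_mu2R` holds** — the `μ = 2` case of the proof of Lemma 15.1 in the `α₁` reading of
record: for `D` large, `j ∈ {1,2,3}`, `1 ≤ l₁ < T`, `l₁ ∈ 𝒩(𝒬)`:
`‖Σ_l ϰ₂(l₁l)ϱ_j(l)/l − e_{2j}‖ ≤ C·α₁`; every input is a tree theorem.
[cite: Zhang2022LandauSiegel, App. B p.107] -/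
theorem stepB_mu2R_holds (c' : ℝ) : Typed.AppendixB.StepB_mu2R c' :=
  stepB_mu2R_of_u009rR c' (stepB_u009rR_holds c')

variable (c' : ℝ) in
/-- `StepB_mu2R` — `_holds` alias of `stepB_mu2R_holds` above under the fact's exact name, stated under the
prover's own binders as section variables (appended 2026-08-28, D-0026 bookkeeping: the proof term is the
existing theorem of this file; no statement, definition or attribute is edited; no new named fact; the
ledger's debt table listed the fact unproved). [cite: Zhang2022LandauSiegel, App. B p.107] -/
theorem _root_.Literature.NumberTheory.LFunctions.Zhang2022.Typed.AppendixB.StepB_mu2R_holds :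
    _root_.Literature.NumberTheory.LFunctions.Zhang2022.Typed.AppendixB.StepB_mu2R c' :=
  _root_.Literature.NumberTheory.LFunctions.Zhang2022.Skeleton.stepB_mu2R_holds (c' := c')

end Literature.NumberTheory.LFunctions.Zhang2022.Skeleton
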